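import Summits.AtomisticToContinuum.BoseEinsteinCondensation.Theorems.BECConjugateDominationInfraredMinimumUncertaintyPhaseSteinCut
import Summits.AtomisticToContinuum.BoseEinsteinCondensation.Theorems.BECConjugateDominationIMUChainGlue
import Summits.AtomisticToContinuum.BoseEinsteinCondensation.Theorems.BECConjugateDominationPositiveMinimiserFinal
import Summits.AtomisticToContinuum.BoseEinsteinCondensation.Theorems.BECConjugateDominationShortDistanceCoherence

/-!
# Route `BECConjugateDomination`, crux `InfraredMinimumUncertainty` (stmt-AtomisticToContinuum-11784):
# circularity certificates of the line `fisher-gaussian-density-mode`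

Lead prover-line-stmt-AtomisticToContinuum-11784-1, 2026-08-16. The conjugate-proxy ladder of the line
(`Theorems/BECConjugateDominationDefs.lean`, `…InfraredMinimumUncertaintyLadder.lean`,
`…InfraredMinimumUncertaintyPhaseSteinCut.lean`) offers three phase-side waypoints for the crux IMU
(`Π_m = N·ν_m·S_m ≤ C` for the positive torus minimiser): FD-V (`FisherDominationV`, the gen-2 registered
hardest stub), its Stein-form core PSD (`PhaseSteinDomination`, the reshape-r1 registered core stub) and DMD
(`DensityMomentDomination`, the typed fallback), each to be paired with a density-side companion — FG
(`FisherGaussianityV`, registered) or FS (`FeynmanSaturation`, typed fallback; `FS ⇒ FG`).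

This file records, as single named equivalences, what the landed necessity and sufficiency theorems say
jointly: **given its companion, each phase-side waypoint is the crux itself** —

* `imu_iff_fisherDominationV_of_fisherGaussianity` : `FG → (IMU ↔ FD-V)`;
* `imu_iff_phaseSteinDomination_of_fisherGaussianity` : `FG → (IMU ↔ PSD)`;
* `imu_iff_densityMomentDomination_of_feynmanSaturation` : `FS → (IMU ↔ DMD)`;
* `imu_iff_fisherDominationV_of_feynmanSaturation`, `imu_iff_phaseSteinDomination_of_feynmanSaturation` :
  the same under the stronger companion FS.

So none of the line's cuts `{FD-V, FG}`, `{PSD, FG}` (+ the three closed stubs), `{DMD, FS}` reduces the crux: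
modulo the companion stub the load-bearing stub is IMU, kernel-checked in both directions (necessity with the
linear field `φ_λ(z) = −λz`, constants `C ↦ 4C + 4`; sufficiency with constants `C_phase · C_density / 16`,
resp. `/4`). These are the certificates cited by `Cruxes/InfraredMinimumUncertainty/Lines/*.dead.md`.

What the crux carries (last theorem, `smoothPeriodicBEC_of_imu`): with the route's glue `imuChainGlue_proof`
(stmt-11790, closed) and its two closed supports `PositiveMinimiser_proof` (stmt-11787) and
`shortDistanceCoherence_proof` (stmt-11789) discharged, IMU together with the two remaining OPEN inputs of the
chain — the crux `PuffFloor` (stmt-11785, sum-rule floor `S_m ≥ ‖k‖/√(‖k‖²+Cρ)`) and the support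
`NearMinimiserStability` (stmt-11788) — gives `SmoothPeriodicBEC` (stmt-11783, thermodynamic-limit torus BEC for
the smooth class). So any line closing IMU closes torus BEC modulo two statements rated L/M: the crux is of
BEC strength, which is what every one of its lines has run into.
Pure logic over landed theorems; no new definitions, no facts.
-/

noncomputable section

namespace Summit.AtomisticToContinuum.BoseEinsteinCondensation.Cruxes.InfraredMinimumUncertainty.FisherGaussianDensityMode

open Summit.AtomisticToContinuum.BoseEinsteinCondensation.Theses.BECConjugateDomination
  (InfraredMinimumUncertainty PuffFloor NearMinimiserStability SmoothPeriodicBEC)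

/-- **Modulo FG, FD-V is the crux**: `FisherGaussianityV → (InfraredMinimumUncertainty ↔ FisherDominationV)`
(`→`: `fisherDomination_of_imu`, unconditional, linear witness field; `←`: `imu_of_fisher`). -/
theorem imu_iff_fisherDominationV_of_fisherGaussianity :
    FisherGaussianityV → (InfraredMinimumUncertainty ↔ FisherDominationV) := fun hFG =>
  ⟨fisherDomination_of_imu, fun h => infraredMinimumUncertainty_iff_named.mp (imu_of_fisher h hFG)⟩

/-- **Modulo FG, the reshape-r1 core PSD is the crux**:
`FisherGaussianityV → (InfraredMinimumUncertainty ↔ PhaseSteinDomination)`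
(`→`: `phaseSteinDomination_of_imu` = `Negative.stub_phaseSteinDomination_of_imu`, p82312, `C ↦ 4C + 4`;
`←`: `imu_of_phaseStein_of_fisherGaussianity`, p86724, through the three closed stubs
`steinIdentity_holds` / `weakEulerLagrange_holds` / `coherenceRegular_holds`). -/
theorem imu_iff_phaseSteinDomination_of_fisherGaussianity :
    FisherGaussianityV → (InfraredMinimumUncertainty ↔ PhaseSteinDomination) := fun hFG =>
  ⟨phaseSteinDomination_of_imu, fun h => imu_of_phaseStein_of_fisherGaussianity h hFG⟩

/-- **Modulo FS, the fallback waypoint DMD is the crux**: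
`FeynmanSaturation → (InfraredMinimumUncertainty ↔ DensityMomentDomination)`
(`→`: `densityMoment_of_imu` = IMU ⇒ FD-V ⇒ DMD by the AM–GM rung `J ≤ 4m₂/(N²‖k‖⁴)`;
`←`: `imu_of_densityMoment`, constants `C₁C₂/4`). -/
theorem imu_iff_densityMomentDomination_of_feynmanSaturation :
    FeynmanSaturation → (InfraredMinimumUncertainty ↔ DensityMomentDomination) := fun hFS =>
  ⟨densityMoment_of_imu, fun h => infraredMinimumUncertainty_iff_named.mp (imu_of_densityMoment h hFS)⟩

/-- **Modulo FS, FD-V is the crux** (FS ⇒ FG, `fisherGaussianity_of_feynmanSaturation`). -/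
theorem imu_iff_fisherDominationV_of_feynmanSaturation :
    FeynmanSaturation → (InfraredMinimumUncertainty ↔ FisherDominationV) := fun hFS =>
  imu_iff_fisherDominationV_of_fisherGaussianity (fisherGaussianity_of_feynmanSaturation hFS)

/-- **Modulo FS, PSD is the crux** (FS ⇒ FG). -/
theorem imu_iff_phaseSteinDomination_of_feynmanSaturation :
    FeynmanSaturation → (InfraredMinimumUncertainty ↔ PhaseSteinDomination) := fun hFS =>
  imu_iff_phaseSteinDomination_of_fisherGaussianity (fisherGaussianity_of_feynmanSaturation hFS)

/-- **The three phase-side waypoints are tied together modulo FG** (so promoting any one of them to an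
item would re-file the crux): `FG → ((FD-V ↔ PSD) ∧ (FD-V → DMD))`; the missing arrow `DMD → FD-V` is exactly
the density-side input FS (`imu_iff_densityMomentDomination_of_feynmanSaturation`). -/
theorem waypoints_modulo_fisherGaussianity :
    FisherGaussianityV →
      (FisherDominationV ↔ PhaseSteinDomination) ∧ (FisherDominationV → DensityMomentDomination) := fun hFG =>
  ⟨(imu_iff_fisherDominationV_of_fisherGaussianity hFG).symm.trans
      (imu_iff_phaseSteinDomination_of_fisherGaussianity hFG),
    densityMoment_of_fisherDomination⟩

/-! ## What the crux carries -/

/-- **IMU is of BEC strength on this route**: together with the two remaining open inputs of the chain —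
the crux `PuffFloor` and the support `NearMinimiserStability` — it yields `SmoothPeriodicBEC`
(thermodynamic-limit ground-state BEC on the torus for the smooth class), by the landed glue
`Theorems.imuChainGlue_proof` with its closed supports `Theorems.PositiveMinimiser_proof` and
`Theorems.shortDistanceCoherence_proof` discharged. -/
theorem smoothPeriodicBEC_of_imu :
    InfraredMinimumUncertainty → PuffFloor → NearMinimiserStability → SmoothPeriodicBEC := fun hI hP hN =>
  Summit.AtomisticToContinuum.BoseEinsteinCondensation.Theorems.imuChainGlue_proof
    Summit.AtomisticToContinuum.BoseEinsteinCondensation.Theorems.PositiveMinimiser_proof hN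
    Summit.AtomisticToContinuum.BoseEinsteinCondensation.Theorems.shortDistanceCoherence_proof hP hI

end Summit.AtomisticToContinuum.BoseEinsteinCondensation.Cruxes.InfraredMinimumUncertainty.FisherGaussianDensityMode

end
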